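import Literature.Computability.QuantumComplexity.SU2TorusGeometry
import HarnessLib

/-!
# Greedy descent in `SU(2)`: candidates that net a ball, and the halving invariant

Topic `Literature/Computability/QuantumComplexity`; sequel of `SU2TorusGeometry.lean`. This is
the convergence analysis of the EXACT braid compiler used for the `PromiseBQP`-hardness of the
Jones polynomial at `k = 5` (Aharonov–Arad 2011 §3.3 invoke Solovay–Kitaev; our machine runs a
simpler greedy scheme whose every decision is an exact trace comparison). Two statements:

* `exists_conj_pow_near` (**candidates net a ball**): let `Net ⊆ SU(2)` be a `1/20`-net, `c` a
  conjugate of `D(θ)` with `0 < θ ≤ e/16`, and `J θ ≥ (π/2) e`. Then every `E` with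
  `‖1 - E‖ ≤ e` is within `e/4` of some `V c^j V⁻¹`, `V ∈ Net`, `j ≤ J`. (Write
  `E = R D(ψ) R⁻¹`, `0 ≤ ψ ≤ (π/2)e`; take `j = ⌊ψ/θ⌋` and `V` within `1/20` of `R R₀⁻¹` where
  `c = R₀ D(θ) R₀⁻¹`; the angle error costs `≤ θ ≤ e/16` and the approximate conjugator costs
  `≤ 2 · ψ · (1/20) ≤ πe/20` by `norm_sub_conj_le`; `1/16 + π/20 < 1/4`.)
* `norm_sub_le_of_greedy` (**one greedy step**): if `‖T - W‖ ≤ e`, the candidate set `C`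
  contains an `e'`-approximation of every `E` with `‖1 - E‖ ≤ e`, and `W'` is at least as close
  to `T` as every `X W`, `X ∈ C`, then `‖T - W'‖ ≤ e'` (because `‖T - XW‖ = ‖TW⁻¹ - X‖`);
  iterating, `norm_sub_le_of_greedy_iterate`: errors `e_t` along any schedule with the netting
  property.

## References

* D. Aharonov, I. Arad, New J. Phys. 13 (2011) 035019, §3.3 [AharonovArad2011].
* C. M. Dawson, M. A. Nielsen, QIC 6 (2006), §3 [DawsonNielsen2006].
-/

noncomputable section

open scoped Matrix.Norms.L2Operator

namespace Literature.Computability.QuantumComplexity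

open Matrix Complex

local notation "SU2" => Matrix.specialUnitaryGroup (Fin 2) ℂ
local notation "M2" => Matrix (Fin 2) (Fin 2) ℂ

/-! ### Norm bookkeeping in `SU(2)` -/

/-- `‖T - X W‖ = ‖T W⁻¹ - X‖`. [folklore] -/
theorem norm_sub_mul_eq (T X W : SU2) :
    ‖(T : M2) - ((X * W : SU2) : M2)‖ = ‖((T * W⁻¹ : SU2) : M2) - (X : M2)‖ := by
  rw [← SolovayKitaev.norm_mul_coe ((T : M2) - ((X * W : SU2) : M2)) W⁻¹, sub_mul, ← Submonoid.coe_mul,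
    ← Submonoid.coe_mul, mul_assoc X W, mul_inv_cancel, mul_one]

/-- `‖1 - T W⁻¹‖ = ‖T - W‖`. [folklore] -/
theorem norm_one_sub_mul_inv (T W : SU2) :
    ‖(1 : M2) - ((T * W⁻¹ : SU2) : M2)‖ = ‖(T : M2) - (W : M2)‖ := by
  rw [← SolovayKitaev.norm_mul_coe ((1 : M2) - ((T * W⁻¹ : SU2) : M2)) W, sub_mul, Matrix.one_mul, Submonoid.coe_mul,
    Matrix.mul_assoc, ← Submonoid.coe_mul, inv_mul_cancel, norm_sub_rev]
  simp

/-- Conjugation is isometric (matrix form with a difference). [folklore] -/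
theorem norm_conj_sub_conj (R : SU2) (X Y : M2) :
    ‖(R : M2) * X * ((R⁻¹ : SU2) : M2) - (R : M2) * Y * ((R⁻¹ : SU2) : M2)‖ = ‖X - Y‖ := by
  rw [← Matrix.sub_mul, ← Matrix.mul_sub, SolovayKitaev.norm_conj]

/-! ### Candidates net a ball -/

/-- **Candidates net a ball.** With a `1/20`-net `Net` of `SU(2)`, a conjugate `c = R₀ D(θ) R₀⁻¹`
of a small rotation, `0 < θ ≤ e/16`, and enough powers, `(π/2) e ≤ J θ`: every `E ∈ SU(2)` with
`‖1 - E‖ ≤ e` is within `e/4` of `V c^j V⁻¹` for some `V ∈ Net`, `j ≤ J`.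
[cite: AharonovArad2011, §3.3] -/
theorem exists_conj_pow_near {Net : List SU2} (hNet : ∀ A : SU2, ∃ V ∈ Net, ‖(A : M2) - (V : M2)‖ ≤ 1 / 20)
    {c R₀ : SU2} {θ e : ℝ} (hc : c = R₀ * torus θ * R₀⁻¹) (hθ0 : 0 < θ) (hθe : θ ≤ e / 16)
    {J : ℕ} (hJ : Real.pi / 2 * e ≤ J * θ) (E : SU2) (hE : ‖(1 : M2) - (E : M2)‖ ≤ e) :
    ∃ V ∈ Net, ∃ j ≤ J, ‖(E : M2) - ((V * c ^ j * V⁻¹ : SU2) : M2)‖ ≤ e / 4 := by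
  obtain ⟨R, ψ, hψ0, hψe, rfl⟩ := exists_conj_torus_of_norm_le E hE
  -- the power
  set j : ℕ := ⌊ψ / θ⌋₊ with hj
  have hjψ : (j : ℝ) * θ ≤ ψ := by
    have := Nat.floor_le (div_nonneg hψ0 hθ0.le); rw [← hj] at this
    calc (j : ℝ) * θ ≤ ψ / θ * θ := mul_le_mul_of_nonneg_right this hθ0.le
      _ = ψ := div_mul_cancel₀ ψ hθ0.ne'
  have hψj : ψ - j * θ ≤ θ := by
    have := Nat.lt_floor_add_one (ψ / θ); rw [← hj] at this
    have h2 : ψ < (j + 1) * θ := by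
      calc ψ = ψ / θ * θ := (div_mul_cancel₀ ψ hθ0.ne').symm
        _ < (j + 1 : ℝ) * θ := mul_lt_mul_of_pos_right (by exact_mod_cast this) hθ0
    linarith
  have hjJ : j ≤ J := by
    have h1 : (j : ℝ) * θ ≤ J * θ := hjψ.trans (hψe.trans hJ)
    exact_mod_cast le_of_mul_le_mul_right h1 hθ0
  -- the conjugator
  obtain ⟨V, hV, hVR⟩ := hNet (R * R₀⁻¹)
  refine ⟨V, hV, j, hjJ, ?_⟩
  have hcj : V * c ^ j * V⁻¹ = (V * R₀) * torus (j * θ) * (V * R₀)⁻¹ := by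
    rw [hc, conj_pow, ← torus_nsmul]; group
  rw [hcj]
  -- split the error
  set D' : SU2 := torus (j * θ)
  have t1 : ‖((R * torus ψ * R⁻¹ : SU2) : M2) - ((R * D' * R⁻¹ : SU2) : M2)‖ ≤ θ := by
    rw [Submonoid.coe_mul, Submonoid.coe_mul, Submonoid.coe_mul, Submonoid.coe_mul, norm_conj_sub_conj]
    refine (norm_torus_sub_torus_le ψ (j * θ)).trans ?_
    rw [abs_of_nonneg (by linarith)]; exact hψj
  have t2 : ‖((R * D' * R⁻¹ : SU2) : M2) - ((V * R₀ * D' * (V * R₀)⁻¹ : SU2) : M2)‖ ≤ Real.pi / 2 * e * (1 / 10) := by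
    -- conjugate by `R⁻¹`: `‖D' - P D' P⁻¹‖` with `P = R⁻¹ V R₀`
    set P : SU2 := R⁻¹ * (V * R₀) with hP
    have e1 : V * R₀ * D' * (V * R₀)⁻¹ = R * (P * D' * P⁻¹) * R⁻¹ := by rw [hP]; group
    rw [e1, show R * D' * R⁻¹ = R * D' * R⁻¹ from rfl]
    have e2 : ‖((R * D' * R⁻¹ : SU2) : M2) - ((R * (P * D' * P⁻¹) * R⁻¹ : SU2) : M2)‖ =
        ‖(D' : M2) - ((P * D' * P⁻¹ : SU2) : M2)‖ := by
      rw [Submonoid.coe_mul, Submonoid.coe_mul, Submonoid.coe_mul, Submonoid.coe_mul, norm_conj_sub_conj]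
    rw [e2, Submonoid.coe_mul, Submonoid.coe_mul, SolovayKitaev.coe_inv]
    refine (norm_sub_conj_le (X := (D' : M2)) P.2.1).trans ?_
    -- `‖D' - 1‖ ≤ jθ ≤ ψ ≤ (π/2) e` and `‖P - 1‖ = ‖V - R R₀⁻¹‖ ≤ 1/20`
    have hD : ‖(D' : M2) - 1‖ ≤ Real.pi / 2 * e := by
      rw [norm_sub_rev]
      refine (norm_one_sub_torus_le _).trans ?_
      rw [abs_of_nonneg (by positivity)]
      exact hjψ.trans hψe
    have hPn : ‖(P : M2) - 1‖ = ‖((R * R₀⁻¹ : SU2) : M2) - (V : M2)‖ := by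
      have e3 : (P : M2) - 1 = ((R⁻¹ : SU2) : M2) * (((V : M2) - ((R * R₀⁻¹ : SU2) : M2)) * (R₀ : M2)) := by
        rw [Matrix.sub_mul, Matrix.mul_sub, ← Submonoid.coe_mul, ← Submonoid.coe_mul, ← Submonoid.coe_mul,
          ← Submonoid.coe_mul, ← hP, show R⁻¹ * (R * R₀⁻¹ * R₀) = 1 by group]
        rfl
      rw [e3, SolovayKitaev.norm_coe_mul, SolovayKitaev.norm_mul_coe, norm_sub_rev]
    have hP' : ‖(P : M2) - 1‖ ≤ 1 / 20 := by rw [hPn]; exact hVR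
    have hpi : 0 ≤ Real.pi / 2 * e := by
      have : 0 ≤ e := by linarith
      positivity
    calc 2 * ‖(D' : M2) - 1‖ * ‖(P : M2) - 1‖ ≤ 2 * (Real.pi / 2 * e) * (1 / 20) := by
          apply mul_le_mul (mul_le_mul_of_nonneg_left hD (by norm_num)) hP' (norm_nonneg _)
          positivity
      _ = Real.pi / 2 * e * (1 / 10) := by ring
  calc ‖((R * torus ψ * R⁻¹ : SU2) : M2) - ((V * R₀ * D' * (V * R₀)⁻¹ : SU2) : M2)‖
      ≤ ‖((R * torus ψ * R⁻¹ : SU2) : M2) - ((R * D' * R⁻¹ : SU2) : M2)‖ +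
          ‖((R * D' * R⁻¹ : SU2) : M2) - ((V * R₀ * D' * (V * R₀)⁻¹ : SU2) : M2)‖ := norm_sub_le_norm_sub_add_norm_sub _ _ _
    _ ≤ θ + Real.pi / 2 * e * (1 / 10) := add_le_add t1 t2
    _ ≤ e / 16 + Real.pi / 2 * e * (1 / 10) := by linarith
    _ ≤ e / 4 := by
        have he : 0 ≤ e := by linarith
        nlinarith [Real.pi_lt_d2, he]

/-! ### The greedy step and its iteration -/

/-- **One greedy step**: if `‖T - W‖ ≤ e`, every `E` with `‖1 - E‖ ≤ e` has an `e'`-close candidate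
in `C`, and `W'` is at least as close to `T` as `X W` for every candidate `X ∈ C`, then
`‖T - W'‖ ≤ e'`. [cite: AharonovArad2011, §3.3] -/
theorem norm_sub_le_of_greedy {C : List SU2} {T W W' : SU2} {e e' : ℝ}
    (hW : ‖(T : M2) - (W : M2)‖ ≤ e)
    (hnet : ∀ E : SU2, ‖(1 : M2) - (E : M2)‖ ≤ e → ∃ X ∈ C, ‖(E : M2) - (X : M2)‖ ≤ e')
    (hopt : ∀ X ∈ C, ‖(T : M2) - (W' : M2)‖ ≤ ‖(T : M2) - ((X * W : SU2) : M2)‖) :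
    ‖(T : M2) - (W' : M2)‖ ≤ e' := by
  obtain ⟨X, hX, hXE⟩ := hnet (T * W⁻¹) (by rw [norm_one_sub_mul_inv]; exact hW)
  calc ‖(T : M2) - (W' : M2)‖ ≤ ‖(T : M2) - ((X * W : SU2) : M2)‖ := hopt X hX
    _ = ‖((T * W⁻¹ : SU2) : M2) - (X : M2)‖ := norm_sub_mul_eq T X W
    _ ≤ e' := hXE

/-- **The greedy invariant**: along a sequence `W t` where each `W (t+1)` is greedily optimal
against the candidate list `C (t+1)`, and the candidates at step `t+1` net the `e t`-ball to
precision `e (t+1)`, the errors follow the schedule: `‖T - W t‖ ≤ e t`.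
[cite: AharonovArad2011, §3.3] -/
theorem norm_sub_le_of_greedy_iterate (C : ℕ → List SU2) (e : ℕ → ℝ) (T : SU2) (W : ℕ → SU2)
    (h0 : ‖(T : M2) - (W 0 : M2)‖ ≤ e 0)
    (hnet : ∀ t, ∀ E : SU2, ‖(1 : M2) - (E : M2)‖ ≤ e t → ∃ X ∈ C (t + 1), ‖(E : M2) - (X : M2)‖ ≤ e (t + 1))
    (hopt : ∀ t, ∀ X ∈ C (t + 1), ‖(T : M2) - (W (t + 1) : M2)‖ ≤ ‖(T : M2) - ((X * W t : SU2) : M2)‖) :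
    ∀ t, ‖(T : M2) - (W t : M2)‖ ≤ e t
  | 0 => h0
  | t + 1 => norm_sub_le_of_greedy (norm_sub_le_of_greedy_iterate C e T W h0 hnet hopt t) (hnet t) (hopt t)

end Literature.Computability.QuantumComplexity

end
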